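import Mathlib
import HarnessLib.Audit
import Summits.PneNP.PneNP.Theorems.PstarPairCoreNoChord
import Summits.PneNP.PneNP.Theorems.PstarPairCoreNormal
import Summits.PneNP.PneNP.Theorems.PstarCoincidenceMatching
import Summits.PneNP.PneNP.Theorems.PstarTerminalPeelableTwelve
import Summits.PneNP.PneNP.Theorems.PstarChordReadTwoCleanCount

/-!
# The kernel criterion for slice genericity: no path-sum sub-core and no short coincidence (ROUND-24, O1; memo g23 §26)

FRONTIER range-avoidance ladder, rung F-N3, ROUND 24 (cell `pnp-ideate`, prover-2 memos `g22/O1-PAIRCORE-g22.md` §19–§22, `g23/O1-TWOCLEAN-g23.md`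
§26; typed target `PstarCoreBoundTargets.TerminalPeelable` (p646951); restricted-model proof complexity — nothing here bears on `P` versus `NP`).

After `PstarChordReadTwoCleanCount.terminalPeelable_of_twoCleanGeneric` the O1 target rests on the census node `TwoCleanGeneric`: two clean
SLICE-GENERIC chords on every centre structure.  `SliceGeneric` (`PstarChordReadLemma`) is the one semantic input.  The g22 pair-core chain
(`PstarChordReadPairCore.sliceGeneric_of_no_pairCore`, `PstarPairCoreNormal.PairCore.normalForm`, `PstarPairCoreNoChord`, `PstarCoincidenceMatching`)
is assembled here into ONE criterion with two named hypotheses, so that the census (planner p3, `r26/failmax.py`) and O2 close it BY NAME: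

* `NoPathSumSubcore I r y J₀ c 𝒢` — BRANCH (A): no non-empty XOR-closed `K₀ ⊆ J₀ ∖ c` is a terminal core for a reader pair `(d₁, d₂)` where `d₁` is
  the PATH SUM of the pair-read of `c` along fold outputs `F₁ ⊆ J₀ ∖ c ∖ K₀` (monomials `F₁`, linear part = the odd vertices of `c + F₁`, all read
  by `K₀`, and `d₁` holds on solutions of `F₁` iff `x_a ⊕ x_b = t`) and `d₂` has monomials in `𝒢 ∪ F₂`, `F₂ ⊆ J₀ ∖ c ∖ K₀`.  (Under O2 =
  `TerminalFiveA` such a `K₀` has at most five outputs; the O2-dependent node of memo g22 §19.2.)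
* `NoShortCoincidence I J₀ c 𝒢` — BRANCH (B), COMBINATORIAL: no non-empty `F₁ ⊆ J₀ ∖ c` containing no outside-gated chord of `J₀`, with `c + F₁`
  everywhere even (i.e. `c` closes an XOR cycle through `F₁`), with at most two `F₁`-chords and no induced matching of three AND pairs in `F₁`.
  This is the kernel form of the planner's V5 filter (at maximal sharing: `F₁` inside two σ-classes, every AND pair containing `σᵢ` or `σⱼ`).
* **`sliceGeneric_of_criterion`**: `NoPathSumSubcore ∧ NoShortCoincidence ⟹ SliceGeneric I y J₀ c 𝒢` (for a menu `𝒢` disjoint from `J₀` with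
  `#(J₀ ∪ 𝒢) ≤ r`).
* `NoPathSumSubcoreLin` / `sliceGeneric_of_criterionLin` — the same with the SHARPER (weaker) (A)-node that keeps the normal form's constraint on
  the second reader's linear part ((T2′): read by `K₀` or an AND variable of a monomial of `d₁, d₂`) and `d₁ ≠ d₂`;
* `TwoCleanCriterion` (OPEN, the assembled node): every centre structure of a terminal core has two distinct outside-gated chords satisfying both
  hypotheses; `twoCleanGeneric_of_criterion : TwoCleanCriterion → TwoCleanGeneric`, hence
  **`terminalPeelable_of_criterion : TwoCleanCriterion → TerminalPeelable`** — O1 from (A)-exclusion (O2's court) and the finite combinatorics of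
  short coincidences (the planner's skeleton census) at two clean chords per structure.

No Assumption A.  Nothing new is assumed: the two hypotheses are exactly what the landed normal form leaves.
-/

set_option linter.dupNamespace false -- `Summit.PneNP.PneNP.…`: summit = sub-problem name (D-0017 single-conjunct layout)

open Finset Module Literature.Computability.Complexity
open Summit.PneNP.PneNP.Theorems.PstarTyped (Typed)
open Summit.PneNP.PneNP.Theorems.PstarSALevel (varSet bdry BoundaryExpanding SimpleOverlap)
open Summit.PneNP.PneNP.Theorems.PstarXCore (xpair mem_xpair)
open Summit.PneNP.PneNP.Theorems.PstarGapOneAll (gval)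
open Summit.PneNP.PneNP.Theorems.PstarCoreBound (XorClosed)
open Summit.PneNP.PneNP.Theorems.PstarChordRepair (IsChord)
open Summit.PneNP.PneNP.Theorems.PstarCoreBoundTargets (Terminal)
open Summit.PneNP.PneNP.Theorems.PstarChordBridgeTools (xpdeg)
open Summit.PneNP.PneNP.Theorems.PstarNorUnitAssembly (xpdeg_singleton_of_mem)
open Summit.PneNP.PneNP.Theorems.PstarChordReadLemma (SliceGeneric)
open Summit.PneNP.PneNP.Theorems.PstarChordReadOutside (OutsideGated)
open Summit.PneNP.PneNP.Theorems.PstarChordReadPairCore (PairCore)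
open Summit.PneNP.PneNP.Theorems.PstarProductRank (polar IsInducedMatching)
open Summit.PneNP.PneNP.Theorems.PstarQuadRank (rad)
open Summit.PneNP.PneNP.Theorems.PstarPairCoreNormal (PairCore.normalForm)
open Summit.PneNP.PneNP.Theorems.PstarPairCoreNoChord (no_chord_in_coincidence)
open Summit.PneNP.PneNP.Theorems.PstarCoincidenceMatching (card_chords_le_two_of_rank_lt_six card_inducedMatching_le_two_of_rank_lt_six)
open Summit.PneNP.PneNP.Theorems.PstarTerminalPeelableTwelve (sliceGeneric_of_no_pairCore')
open Summit.PneNP.PneNP.Theorems.PstarXCore (xverts)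
open Summit.PneNP.PneNP.Theorems.PstarCoreBoundTargets (TerminalPeelable)
open Summit.PneNP.PneNP.Theorems.PstarChordReadTwoCleanCount (TwoCleanGeneric terminalPeelable_of_twoCleanGeneric)

namespace Summit.PneNP.PneNP.Theorems.PstarSliceGenericCriterion

variable {n m : ℕ}

/-- **BRANCH (A) EXCLUDED: no PATH-SUM SUB-CORE of the chord `c` inside `J₀ ∖ c`** (menu `𝒢`).  No non-empty XOR-closed `K₀ ⊆ J₀ ∖ c` is a
terminal core for readers `(d₁, d₂)` with: `d₁` of monomial set `F₁ ⊆ (J₀ ∖ c) ∖ K₀`, linear part the odd vertices of the XOR multigraph of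
`c + F₁` (all of them variables of `K₀`), holding on solutions of `F₁` iff `x_{vars c 0} ⊕ x_{vars c 1} = t`; and `d₂` of monomial set inside
`𝒢 ∪ F₂`, `F₂ ⊆ (J₀ ∖ c) ∖ K₀`.  FRONTIER node (O2-dependent: under `TerminalFiveA` such `K₀` have at most five outputs). -/
def NoPathSumSubcore (I : LocalMap 4 n m) (r : ℕ) (y : Fin m → Bool) (J₀ : Finset (Fin m)) (c : Fin m) (𝒢 : Finset (Fin m)) : Prop :=
  ∀ K₀ ⊆ J₀.erase c, K₀.Nonempty → XorClosed I K₀ →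
    ∀ (F₁ F₂ : Finset (Fin m)) (t : Bool) (d₁ d₂ : Finset (Fin n) × Finset (Fin m) × Bool),
      F₁ ⊆ (J₀.erase c) \ K₀ → F₂ ⊆ (J₀.erase c) \ K₀ → d₁.2.1 = F₁ → d₂.2.1 ⊆ 𝒢 ∪ F₂ →
      (∀ v, v ∈ d₁.1 ↔ Odd (xpdeg I (insert c F₁) v)) → (∀ v ∈ d₁.1, ∃ f ∈ K₀, v ∈ varSet I f) →
      (∀ z : Fin n → Bool, (∀ f ∈ F₁, I.eval z f = y f) →
        (gval I d₁.1 d₁.2.1 z = d₁.2.2 ↔ xor (z (I.vars c 0)) (z (I.vars c 1)) = t)) →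
      ¬ Terminal I r y K₀ d₁ d₂

/-- **BRANCH (B) EXCLUDED: no SHORT COINCIDENCE at the chord `c`** (menu `𝒢`) — purely combinatorial.  No non-empty `F₁ ⊆ J₀ ∖ c` such that:
no member of `F₁` is an outside-gated chord of `J₀`; every variable has even XOR slot-degree in `c + F₁`; at most two members of `F₁` are
`F₁`-chords (both AND variables on the boundary of `F₁`); and the AND pairs of `F₁` contain no induced matching of size three. -/
def NoShortCoincidence (I : LocalMap 4 n m) (J₀ : Finset (Fin m)) (c : Fin m) (𝒢 : Finset (Fin m)) : Prop :=
  ∀ F₁ ⊆ J₀.erase c, F₁.Nonempty →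
    (∀ c' ∈ F₁, IsChord I J₀ c' → ¬ OutsideGated I J₀ 𝒢 c') →
    (∀ v, Even (xpdeg I (insert c F₁) v)) →
    (F₁.filter fun f => I.vars f 2 ∈ bdry I F₁ ∧ I.vars f 3 ∈ bdry I F₁).card ≤ 2 →
    (∀ M : Finset (Fin m), IsInducedMatching F₁ M (fun j => I.vars j 2) (fun j => I.vars j 3) → M.card ≤ 2) → False

variable {I : LocalMap 4 n m} {r : ℕ} {y : Fin m → Bool} {J₀ 𝒢 : Finset (Fin m)} {c : Fin m}

/-- **THE CRITERION: no path-sum sub-core and no short coincidence make the chord slice-generic.** -/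
theorem sliceGeneric_of_criterion (hI : I.IsPure xorAndPred) (hT : Typed I) (hS : SimpleOverlap I) (hB : BoundaryExpanding r I)
    (hcJ : c ∈ J₀) (hdisj : Disjoint J₀ 𝒢) (hr : (J₀ ∪ 𝒢).card ≤ r)
    (hA : NoPathSumSubcore I r y J₀ c 𝒢) (hBc : NoShortCoincidence I J₀ c 𝒢) : SliceGeneric I y J₀ c 𝒢 := by
  classical
  have hJr : J₀.card ≤ r := (card_le_card subset_union_left).trans hr
  refine sliceGeneric_of_no_pairCore' hI hT hS hB hJr hdisj fun K hK C G t b _ _ hG hPC => ?_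
  have hKJ : K ⊆ J₀ := hK.trans (erase_subset c J₀)
  have hcK : c ∉ K := fun h => (mem_erase.1 (hK h)).1 rfl
  have hKr : K.card < r := lt_of_lt_of_le ((card_le_card hK).trans_lt (card_erase_lt_of_mem hcJ)) hJr
  have hdisjKG : Disjoint K G := (hdisj.mono_left hKJ).mono_right hG
  have hrKG : (K ∪ G).card ≤ r := (card_le_card (union_subset_union hKJ hG)).trans hr
  obtain ⟨K₀, F₁, F₂, d₁, d₂, hK₀, hF₁, hF₂, -, -, hm₁, hlin, hslice, hD₂, hX, hread, -, -, -, hflip, hterm, hempty⟩ :=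
    PairCore.normalForm hI hT hS hB hPC hKr hcK hdisjKG hrKG
  have hF₁' : F₁ ⊆ K := fun f hf => (mem_sdiff.1 (hF₁ hf)).1
  have hF₂' : F₂ ⊆ K := fun f hf => (mem_sdiff.1 (hF₂ hf)).1
  by_cases hK₀e : K₀ = ∅
  · -- branch (B): the empty-core coincidence
    obtain ⟨hd₁, heven, hU, hrk₁, -⟩ := hempty hK₀e
    rw [hm₁] at hrk₁
    have hF₁ne : F₁.Nonempty := by
      rw [nonempty_iff_ne_empty]
      intro hF₁e
      have h := heven (I.vars c 0)
      rw [hF₁e, insert_empty, xpdeg_singleton_of_mem I hI ((mem_xpair I).2 (Or.inl rfl))] at h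
      exact absurd h (by decide)
    have hU' : ∀ z : Fin n → Bool, ¬ (gval I ∅ F₁ z = d₁.2.2 ∧ gval I d₂.1 (G ∪ F₂) z = d₂.2.2) := by
      intro z hz
      refine hU z ⟨?_, ?_⟩
      · rw [hd₁, hm₁]; exact hz.1
      · rw [hD₂.1]; exact hz.2
    have hflip' : ∀ g ∈ K ∪ G, ∃ z : Fin n → Bool,
        (gval I ∅ F₁ z = d₁.2.2 ↔ g ∉ F₁) ∧ (gval I d₂.1 (G ∪ F₂) z = d₂.2.2 ↔ g ∉ G ∪ F₂) := by
      intro g hg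
      have hg' : g ∈ K \ K₀ ∪ G := by rw [hK₀e, sdiff_empty]; exact hg
      obtain ⟨z, -, hz₁, hz₂⟩ := hflip g hg'
      refine ⟨z, ?_, ?_⟩
      · rw [hd₁, hm₁] at hz₁; exact hz₁
      · rw [hD₂.1] at hz₂; exact hz₂
    refine hBc F₁ (hF₁'.trans hK) hF₁ne (fun c' hc' hch hO => ?_) heven (card_chords_le_two_of_rank_lt_six I hI hrk₁)
      fun M hM => card_inducedMatching_le_two_of_rank_lt_six I hM hrk₁
    exact no_chord_in_coincidence hI hS hKJ hcK hF₁' hF₂' hdisjKG hG heven hU' hflip' hc' hch hO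
  · -- branch (A): a path-sum sub-core
    have hK₀ne : K₀.Nonempty := nonempty_iff_ne_empty.2 hK₀e
    refine hA K₀ (hK₀.trans hK) hK₀ne hX F₁ F₂ t d₁ d₂ (hF₁.trans (sdiff_subset_sdiff hK (Subset.refl _)))
      (hF₂.trans (sdiff_subset_sdiff hK (Subset.refl _))) hm₁ ?_ hlin hread hslice (hterm hK₀ne)
    rw [hD₂.1]
    exact union_subset_union hG (Subset.refl _)


/-! ## The (A)-node with the linear-part constraint of the normal form -/

/-- **BRANCH (A), SHARPER NODE**: as `NoPathSumSubcore`, but the excluded sub-cores also satisfy the normal form's constraint (T2′) on the second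
reader's LINEAR part — every linear variable of `d₂` is read by `K₀` or is an AND variable of a monomial of `d₁` or `d₂` — and `d₁ ≠ d₂`.  Weaker
hypothesis, same conclusion (`sliceGeneric_of_criterionLin`); this is the node a census of small sub-cores certifies. -/
def NoPathSumSubcoreLin (I : LocalMap 4 n m) (r : ℕ) (y : Fin m → Bool) (J₀ : Finset (Fin m)) (c : Fin m) (𝒢 : Finset (Fin m)) : Prop :=
  ∀ K₀ ⊆ J₀.erase c, K₀.Nonempty → XorClosed I K₀ →
    ∀ (F₁ F₂ : Finset (Fin m)) (t : Bool) (d₁ d₂ : Finset (Fin n) × Finset (Fin m) × Bool),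
      F₁ ⊆ (J₀.erase c) \ K₀ → F₂ ⊆ (J₀.erase c) \ K₀ → d₁.2.1 = F₁ → d₂.2.1 ⊆ 𝒢 ∪ F₂ → d₁ ≠ d₂ →
      (∀ v, v ∈ d₁.1 ↔ Odd (xpdeg I (insert c F₁) v)) → (∀ v ∈ d₁.1, ∃ f ∈ K₀, v ∈ varSet I f) →
      (∀ v ∈ d₂.1, (∃ f ∈ K₀, v ∈ varSet I f) ∨ ∃ g ∈ d₁.2.1 ∪ d₂.2.1, I.vars g 2 = v ∨ I.vars g 3 = v) →
      (∀ z : Fin n → Bool, (∀ f ∈ F₁, I.eval z f = y f) →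
        (gval I d₁.1 d₁.2.1 z = d₁.2.2 ↔ xor (z (I.vars c 0)) (z (I.vars c 1)) = t)) →
      ¬ Terminal I r y K₀ d₁ d₂

/-- The sharper node is weaker. -/
theorem noPathSumSubcoreLin_of (h : NoPathSumSubcore I r y J₀ c 𝒢) : NoPathSumSubcoreLin I r y J₀ c 𝒢 :=
  fun K₀ hK₀ hne hX F₁ F₂ t d₁ d₂ hF₁ hF₂ hm₁ hm₂ _ hlin hread _ hslice => h K₀ hK₀ hne hX F₁ F₂ t d₁ d₂ hF₁ hF₂ hm₁ hm₂ hlin hread hslice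

/-- **THE CRITERION with the sharper (A)-node.** -/
theorem sliceGeneric_of_criterionLin (hI : I.IsPure xorAndPred) (hT : Typed I) (hS : SimpleOverlap I) (hB : BoundaryExpanding r I)
    (hcJ : c ∈ J₀) (hdisj : Disjoint J₀ 𝒢) (hr : (J₀ ∪ 𝒢).card ≤ r)
    (hA : NoPathSumSubcoreLin I r y J₀ c 𝒢) (hBc : NoShortCoincidence I J₀ c 𝒢) : SliceGeneric I y J₀ c 𝒢 := by
  classical
  have hJr : J₀.card ≤ r := (card_le_card subset_union_left).trans hr
  refine sliceGeneric_of_no_pairCore' hI hT hS hB hJr hdisj fun K hK C G t b _ _ hG hPC => ?_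
  have hKJ : K ⊆ J₀ := hK.trans (erase_subset c J₀)
  have hcK : c ∉ K := fun h => (mem_erase.1 (hK h)).1 rfl
  have hKr : K.card < r := lt_of_lt_of_le ((card_le_card hK).trans_lt (card_erase_lt_of_mem hcJ)) hJr
  have hdisjKG : Disjoint K G := (hdisj.mono_left hKJ).mono_right hG
  have hrKG : (K ∪ G).card ≤ r := (card_le_card (union_subset_union hKJ hG)).trans hr
  obtain ⟨K₀, F₁, F₂, d₁, d₂, hK₀, hF₁, hF₂, -, hne, hm₁, hlin, hslice, hD₂, hX, hread, hread₂, -, -, hflip, hterm, hempty⟩ :=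
    PairCore.normalForm hI hT hS hB hPC hKr hcK hdisjKG hrKG
  have hF₁' : F₁ ⊆ K := fun f hf => (mem_sdiff.1 (hF₁ hf)).1
  have hF₂' : F₂ ⊆ K := fun f hf => (mem_sdiff.1 (hF₂ hf)).1
  by_cases hK₀e : K₀ = ∅
  · -- branch (B): exactly as in `sliceGeneric_of_criterion`
    obtain ⟨hd₁, heven, hU, hrk₁, -⟩ := hempty hK₀e
    rw [hm₁] at hrk₁
    have hF₁ne : F₁.Nonempty := by
      rw [nonempty_iff_ne_empty]
      intro hF₁e
      have h := heven (I.vars c 0)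
      rw [hF₁e, insert_empty, xpdeg_singleton_of_mem I hI ((mem_xpair I).2 (Or.inl rfl))] at h
      exact absurd h (by decide)
    have hU' : ∀ z : Fin n → Bool, ¬ (gval I ∅ F₁ z = d₁.2.2 ∧ gval I d₂.1 (G ∪ F₂) z = d₂.2.2) := by
      intro z hz
      refine hU z ⟨?_, ?_⟩
      · rw [hd₁, hm₁]; exact hz.1
      · rw [hD₂.1]; exact hz.2
    have hflip' : ∀ g ∈ K ∪ G, ∃ z : Fin n → Bool,
        (gval I ∅ F₁ z = d₁.2.2 ↔ g ∉ F₁) ∧ (gval I d₂.1 (G ∪ F₂) z = d₂.2.2 ↔ g ∉ G ∪ F₂) := by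
      intro g hg
      have hg' : g ∈ K \ K₀ ∪ G := by rw [hK₀e, sdiff_empty]; exact hg
      obtain ⟨z, -, hz₁, hz₂⟩ := hflip g hg'
      refine ⟨z, ?_, ?_⟩
      · rw [hd₁, hm₁] at hz₁; exact hz₁
      · rw [hD₂.1] at hz₂; exact hz₂
    refine hBc F₁ (hF₁'.trans hK) hF₁ne (fun c' hc' hch hO => ?_) heven (card_chords_le_two_of_rank_lt_six I hI hrk₁)
      fun M hM => card_inducedMatching_le_two_of_rank_lt_six I hM hrk₁
    exact no_chord_in_coincidence hI hS hKJ hcK hF₁' hF₂' hdisjKG hG heven hU' hflip' hc' hch hO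
  · -- branch (A), with the linear-part constraint
    have hK₀ne : K₀.Nonempty := nonempty_iff_ne_empty.2 hK₀e
    refine hA K₀ (hK₀.trans hK) hK₀ne hX F₁ F₂ t d₁ d₂ (hF₁.trans (sdiff_subset_sdiff hK (Subset.refl _)))
      (hF₂.trans (sdiff_subset_sdiff hK (Subset.refl _))) hm₁ ?_ hne hlin hread hread₂ hslice (hterm hK₀ne)
    rw [hD₂.1]
    exact union_subset_union hG (Subset.refl _)

/-! ## The assembled census node -/

/-- **`TwoCleanCriterion` (OPEN): two clean chords passing the criterion on every centre structure.**  For every pure typed `(r,3/2)`-expanding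
instance with simple overlaps and every terminal core `(J₀, w₁, w₂)` carrying a non-empty leafless set of non-chords, there are two distinct
outside-gated chords `cᵢ, cⱼ` of `J₀` with `NoPathSumSubcore` and `NoShortCoincidence` at both (menu `G₁ ∪ G₂`).  FRONTIER: the (A) halves are
O2-type statements, the (B) halves finite combinatorics (planner census `r26/failmax.py`: at most two chords of a tri/c4a centre structure fail). -/
@[conjecture] def TwoCleanCriterion : Prop :=
  ∀ (n m r : ℕ) (I : LocalMap 4 n m), I.IsPure xorAndPred → Typed I → SimpleOverlap I → BoundaryExpanding r I →
    ∀ (y : Fin m → Bool) (J₀ : Finset (Fin m)) (w₁ w₂ : Finset (Fin n) × Finset (Fin m) × Bool), Terminal I r y J₀ w₁ w₂ →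
      (∃ S ⊆ J₀, S.Nonempty ∧ (∀ w ∈ xverts I S, 2 ≤ xpdeg I S w) ∧ ∀ f ∈ S, ¬ IsChord I J₀ f) →
      ∃ cᵢ ∈ J₀, ∃ cⱼ ∈ J₀, cᵢ ≠ cⱼ ∧ IsChord I J₀ cᵢ ∧ IsChord I J₀ cⱼ ∧
        OutsideGated I J₀ (w₁.2.1 ∪ w₂.2.1) cᵢ ∧ OutsideGated I J₀ (w₁.2.1 ∪ w₂.2.1) cⱼ ∧
        NoPathSumSubcore I r y J₀ cᵢ (w₁.2.1 ∪ w₂.2.1) ∧ NoShortCoincidence I J₀ cᵢ (w₁.2.1 ∪ w₂.2.1) ∧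
        NoPathSumSubcore I r y J₀ cⱼ (w₁.2.1 ∪ w₂.2.1) ∧ NoShortCoincidence I J₀ cⱼ (w₁.2.1 ∪ w₂.2.1)

/-- **The criterion node implies `TwoCleanGeneric`.** -/
theorem twoCleanGeneric_of_criterion (h : TwoCleanCriterion) : TwoCleanGeneric := by
  intro n m r I hI hT hS hB y J₀ w₁ w₂ ht hS₀
  obtain ⟨cᵢ, hcᵢ, cⱼ, hcⱼ, hne, hchᵢ, hchⱼ, hOᵢ, hOⱼ, hAᵢ, hBᵢ, hAⱼ, hBⱼ⟩ := h n m r I hI hT hS hB y J₀ w₁ w₂ ht hS₀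
  have hdisj : Disjoint J₀ (w₁.2.1 ∪ w₂.2.1) := disjoint_union_right.2 ⟨ht.2.2.2.1, ht.2.2.2.2.1⟩
  have hr : (J₀ ∪ (w₁.2.1 ∪ w₂.2.1)).card ≤ r := by rw [← union_assoc]; exact ht.2.2.2.2.2.1
  exact ⟨cᵢ, hcᵢ, cⱼ, hcⱼ, hne, hchᵢ, hchⱼ, hOᵢ, hOⱼ, sliceGeneric_of_criterion hI hT hS hB hcᵢ hdisj hr hAᵢ hBᵢ,
    sliceGeneric_of_criterion hI hT hS hB hcⱼ hdisj hr hAⱼ hBⱼ⟩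

/-- **O1 FROM THE CRITERION NODE.** -/
theorem terminalPeelable_of_criterion (h : TwoCleanCriterion) : TerminalPeelable :=
  terminalPeelable_of_twoCleanGeneric (twoCleanGeneric_of_criterion h)

end Summit.PneNP.PneNP.Theorems.PstarSliceGenericCriterion
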